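import Summits.CriticalPhenomena.PercolationContinuityZ3.Theorems.Transplant.GrigorchukSectionLifts
import Mathlib.Analysis.SpecialFunctions.Pow.Real
import HarnessLib

/-!
# THE FIRST GRIGORCHUK GROUP HAS SUPERPOLYNOMIAL GROWTH — KERNEL (Grigorchuk 1984's lower bound: `𝔊` is commensurable with `𝔊 × 𝔊`);
# with «GrigorchukSubexponentialGrowth» (p611590): INTERMEDIATE growth

builds on p205010 (kernel theorem, internal audit signed; external expert review pending) — nothing in this file uses p205010; growth only (the HYPOTHESIS
side of the polynomial-growth node), no `θ(p_c)` statement, no node touched.  Lane `prim-bschramm`, seat `prim-bschramm-gen-1` gen 8 (GEN pen; offer O-GR2 file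
H2, lead g25 GO 2026-08-28T07:42Z; refuter's math note p5-g31 #7990 followed: division-free shapes, everything in `ℕ` until the last comparison).  Helper file
(`--supports stmt-CriticalPhenomena-4575 --as helper`).  Def-free; class rows only — no `@[conjecture]` declared, edited or claimed; nothing about
`BenjaminiSchramm1996_conj4_endState`.  WORD DISCIPLINE: what is typed is 'no bound `C·(n+1)^D`' (and, with p611590, 'no exponential rate') — NO growth
EXPONENT is typed (neither `e^{√n} ≲ γ` nor `γ ≲ e^{n^0.768}`); the polynomial-growth node `BenjaminiSchramm1996_conj4_polynomialGrowth` is a CONDITIONAL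
statement whose HYPOTHESIS fails on `Cay(𝔊; a,b,c,d)` — it 'does not apply' there; nothing about its truth.

CONTENT (`Cay = SimpleGraph.mulCayley ↑{aG, bG, cG, dG}` on `Γ = ↥grigorchukGroup`; `wordBall n` = H1's word-length ball):
* §1 `wordBall n = B(1, n)` as sets (`Letter.toG_ne_one`, walks ↔ words), so `ballVolume Cay 1 n = (wordBall n).card`.
* §2 THE SQUARING INEQUALITY **`card_wordBall_sq_le : ∃ T c L, 0 < T ∧ 1 ≤ L ∧ ∀ n, |wordBall n|² ≤ T²·|wordBall (2L(n+c))|`** — `|B(n)| ≤ T·|R ∩ B(n+c)|` (H1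
  `card_wordBall_le`) and the INJECTION `(x, y) ↦ x̂₀·ŷ₁` from `(R ∩ B(m))²` into `B(2Lm)` (H1 `exists_section_lifts`; `ψ(x̂₀ŷ₁) = (x, y)` by F-MP1
  `sec_not_eq_one`, and `ψ` is injective, p590401 `eq_of_sec_eq`).
* §3 ITERATION: along `n_{k+1} = 2L(n_k + c)`, `T²·2^(2^k) ≤ |wordBall n_k|` and `n_k ≤ M^k n₀`.
* §4 **`not_polynomialGrowth_cayley : ¬ ∃ C D : ℝ, ∀ x n, (ballVolume Cay x n : ℝ) ≤ C·(n+1)^D`** — exactly the growth hypothesis of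
  `BenjaminiSchramm1996_conj4_polynomialGrowth`, absent for `Cay(𝔊; a,b,c,d)` (`A·Q^k < 2^(2^k)` eventually, `k² < 2^k`).
[cite: Grigorchuk1984, Thm. (lower bound; 𝔊 commensurable with 𝔊 × 𝔊)] [cite: BartholdiErschler2012, §3.1 (ψ injective on St(1))] [cite: LyonsPeres2016, §7.2]
-/

noncomputable section

namespace Summit.CriticalPhenomena.PercolationContinuityZ3.Theorems.Transplant

namespace Grigorchuk

open SimpleGraph Literature.Barriers.CriticalPhenomena Literature.Probability.Percolation Literature.Probability.LatticeModels
open scoped Classical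

/-! ## §1 Word balls are the graph balls of `Cay(𝔊; a, b, c, d)` -/

/-- The letters are not the identity (each moves some ray). [cite: Grigorchuk1980, definition of a, b, c, d] -/
theorem Letter.toG_ne_one (ℓ : Letter) : ℓ.toG ≠ 1 := by
  intro h
  have h' : ℓ.toPerm = 1 := by rw [← Letter.coe_toG, h]; rfl
  have hb : genB (cons false rho) ≠ cons false rho := by
    rw [genB_cons_false]; intro e; exact absurd (congrFun (cons_injective false e) 0) (by rw [genA_rho_zero]; decide)
  rcases ℓ with _ | ⟨_ | _ | _⟩
  · have e : genA rho = rho := by rw [show genA = Letter.toPerm .a from rfl, h']; rfl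
    have h0 : rho 0 = false := by rw [← congrFun e 0]; exact genA_rho_zero
    exact absurd h0 (by simp [rho])
  · exact hb (by rw [show genB = Letter.toPerm (.x .b) from rfl, h']; rfl)
  · have hc : genC (cons false rho) ≠ cons false rho := by
      rw [genC_cons_false]; intro e; exact absurd (congrFun (cons_injective false e) 0) (by rw [genA_rho_zero]; decide)
    exact hc (by rw [show genC = Letter.toPerm (.x .c) from rfl, h']; rfl)
  · have hd : genD (cons true (cons false rho)) ≠ cons true (cons false rho) := by
      rw [genD_cons_true]; intro e; exact hb (cons_injective true e)
    exact hd (by rw [show genD = Letter.toPerm (.x .d) from rfl, h']; rfl)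

/-- Right multiplication by a letter is an edge of `Cay(𝔊; a, b, c, d)`. [cite: LyonsPeres2016, §7.2 (Cayley graphs)] -/
theorem adj_mul_toG (u : ↥grigorchukGroup) (ℓ : Letter) :
    (mulCayley (↑({aG, bG, cG, dG} : Finset ↥grigorchukGroup) : Set ↥grigorchukGroup)).Adj u (u * ℓ.toG) := by
  rw [mulCayley_adj']
  refine ⟨fun h => Letter.toG_ne_one ℓ (mul_left_cancel (a := u) (by rw [mul_one]; exact h.symm)), ℓ.toG, ?_, Or.inl rfl⟩
  rw [Finset.mem_coe]
  rcases ℓ with _ | ⟨_ | _ | _⟩ <;> simp [Letter.toG]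

/-- A word of length `k` from `u` is a walk of length `k`: `u · Π w ∈ B(u, |w|)`. [cite: LyonsPeres2016, §7.2 (word metric = graph metric)] -/
theorem prod_mem_graphBall (w : List Letter) : ∀ u : ↥grigorchukGroup,
    u * (w.map Letter.toG).prod ∈ graphBall (mulCayley (↑({aG, bG, cG, dG} : Finset ↥grigorchukGroup) : Set ↥grigorchukGroup)) u w.length := by
  induction w with
  | nil => intro u; rw [List.map_nil, List.prod_nil, mul_one]; exact mem_graphBall_self _ u 0
  | cons ℓ w ih =>
    intro u
    obtain ⟨p, hp⟩ := ih (u * ℓ.toG)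
    refine ⟨SimpleGraph.Walk.cons (adj_mul_toG u ℓ) (p.copy rfl (by rw [List.map_cons, List.prod_cons, mul_assoc])), ?_⟩
    rw [SimpleGraph.Walk.length_cons, SimpleGraph.Walk.length_copy, List.length_cons]; omega

/-- **`wordBall n = B(1, n)`** in `Cay(𝔊; a, b, c, d)`. [cite: LyonsPeres2016, §7.2] -/
theorem coe_wordBall_eq_graphBall (n : ℕ) :
    (↑(wordBall n) : Set ↥grigorchukGroup) = graphBall (mulCayley (↑({aG, bG, cG, dG} : Finset ↥grigorchukGroup) : Set ↥grigorchukGroup)) 1 n := by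
  ext g
  rw [Finset.mem_coe, mem_wordBall]
  constructor
  · rintro ⟨w, hw, rfl⟩
    have h := prod_mem_graphBall w 1
    rw [one_mul] at h
    exact graphBall_mono _ 1 hw h
  · rintro ⟨p, hp⟩
    obtain ⟨w, hw, hprod⟩ := exists_word_of_walk p
    refine ⟨w, hw.trans hp, Subtype.ext ?_⟩
    rw [coe_prod_toG, ← hprod, Subgroup.coe_one, one_mul]

/-- **`|B(1, n)| = |wordBall n|`.** [folklore] -/
theorem ballVolume_eq_card_wordBall (n : ℕ) :
    ballVolume (mulCayley (↑({aG, bG, cG, dG} : Finset ↥grigorchukGroup) : Set ↥grigorchukGroup)) 1 n = (wordBall n).card := by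
  rw [ballVolume, ← coe_wordBall_eq_graphBall, Set.ncard_coe_finset]

/-! ## §2 The squaring inequality -/

/-- **THE SQUARING INEQUALITY: `|wordBall n|² ≤ T²·|wordBall (2L(n + c))|`** for constants `T ≥ 1`, `L ≥ 1`, `c` — `𝔊` grows at least like its own square.
[cite: Grigorchuk1984, proof of the lower bound] -/
theorem card_wordBall_sq_le : ∃ T c L : ℕ, 0 < T ∧ 1 ≤ L ∧ ∀ n : ℕ, (wordBall n).card ^ 2 ≤ T ^ 2 * (wordBall (2 * (L * (n + c)))).card := by
  obtain ⟨T, c, hT, hcount⟩ := card_wordBall_le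
  obtain ⟨L₀, hL₀⟩ := exists_section_lifts
  -- chosen lifts (functions of the element and of the two membership proofs)
  choose G hGr hGs hGw using hL₀
  refine ⟨T, c, max L₀ 1, hT, le_max_right _ _, fun n => ?_⟩
  set m : ℕ := n + c
  set RB : Finset ↥grigorchukGroup := (wordBall m).filter fun x => x ∈ (secR false).range with hRB
  -- the injection `(x, y) ↦ x̂₀ · ŷ₁`
  have hinj : (RB ×ˢ RB).card ≤ (wordBall (2 * (max L₀ 1 * m))).card := by
    let F : ↥grigorchukGroup × ↥grigorchukGroup → ↥grigorchukGroup := fun p =>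
      if h : (p.1 ∈ (secR false).range ∧ p.1 ∈ wordBall m) ∧ (p.2 ∈ (secR false).range ∧ p.2 ∈ wordBall m) then
        G false m p.1 h.1.1 h.1.2 * G true m p.2 h.2.1 h.2.2 else 1
    have hmemRB : ∀ {x}, x ∈ RB → x ∈ (secR false).range ∧ x ∈ wordBall m := fun hx => by
      rw [hRB, Finset.mem_filter] at hx; exact ⟨hx.2, hx.1⟩
    refine Finset.card_le_card_of_injOn F (fun p hp => ?_) (fun p hp p' hp' e => ?_)
    · rw [Finset.mem_coe, Finset.mem_product] at hp
      have h := And.intro (hmemRB hp.1) (hmemRB hp.2)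
      rw [Finset.mem_coe, show F p = G false m p.1 h.1.1 h.1.2 * G true m p.2 h.2.1 h.2.2 from dif_pos h]
      have h2 : 2 * (max L₀ 1 * m) = max L₀ 1 * m + max L₀ 1 * m := by ring
      rw [h2]
      exact mul_mem_wordBall (wordBall_mono (Nat.mul_le_mul_right m (le_max_left _ _)) (hGw false m p.1 h.1.1 h.1.2))
        (wordBall_mono (Nat.mul_le_mul_right m (le_max_left _ _)) (hGw true m p.2 h.2.1 h.2.2))
    · rw [Finset.mem_coe, Finset.mem_product] at hp hp'
      have h := And.intro (hmemRB hp.1) (hmemRB hp.2)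
      have h' := And.intro (hmemRB hp'.1) (hmemRB hp'.2)
      have eF : G false m p.1 h.1.1 h.1.2 * G true m p.2 h.2.1 h.2.2 = G false m p'.1 h'.1.1 h'.1.2 * G true m p'.2 h'.2.1 h'.2.2 := by
        have e1 : F p = G false m p.1 h.1.1 h.1.2 * G true m p.2 h.2.1 h.2.2 := dif_pos h
        have e2 : F p' = G false m p'.1 h'.1.1 h'.1.2 * G true m p'.2 h'.2.1 h'.2.2 := dif_pos h'
        rw [← e1, ← e2, e]
      -- read the two sections: `φ₀(x̂₀ ŷ₁) = x`, `φ₁(x̂₀ ŷ₁) = y`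
      have key : ∀ (x y : ↥grigorchukGroup) (hx : (x : Equiv.Perm Ray) ∈ rist false) (hy : (y : Equiv.Perm Ray) ∈ rist true),
          sec false ⟨((x * y : ↥grigorchukGroup) : Equiv.Perm Ray), stabOne.mul_mem (rist_le_stabOne false hx) (rist_le_stabOne true hy)⟩ =
            sec false ⟨(x : Equiv.Perm Ray), rist_le_stabOne false hx⟩ ∧
          sec true ⟨((x * y : ↥grigorchukGroup) : Equiv.Perm Ray), stabOne.mul_mem (rist_le_stabOne false hx) (rist_le_stabOne true hy)⟩ =
            sec true ⟨(y : Equiv.Perm Ray), rist_le_stabOne true hy⟩ := by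
        intro x y hx hy
        have e : (⟨((x * y : ↥grigorchukGroup) : Equiv.Perm Ray), stabOne.mul_mem (rist_le_stabOne false hx) (rist_le_stabOne true hy)⟩ : ↥stabOne) =
            ⟨(x : Equiv.Perm Ray), rist_le_stabOne false hx⟩ * ⟨(y : Equiv.Perm Ray), rist_le_stabOne true hy⟩ := rfl
        rw [e, map_mul, map_mul]
        have h1 : sec false ⟨(y : Equiv.Perm Ray), rist_le_stabOne true hy⟩ = 1 := by
          have := sec_not_eq_one hy; rwa [Bool.not_true] at this
        have h2 : sec true ⟨(x : Equiv.Perm Ray), rist_le_stabOne false hx⟩ = 1 := by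
          have := sec_not_eq_one hx; rwa [Bool.not_false] at this
        rw [h1, h2, mul_one, one_mul]; exact ⟨rfl, rfl⟩
      obtain ⟨k0, k1⟩ := key _ _ (hGr false m p.1 h.1.1 h.1.2) (hGr true m p.2 h.2.1 h.2.2)
      obtain ⟨k0', k1'⟩ := key _ _ (hGr false m p'.1 h'.1.1 h'.1.2) (hGr true m p'.2 h'.2.1 h'.2.2)
      have hs0 := hGs false m p.1 h.1.1 h.1.2
      have hs1 := hGs true m p.2 h.2.1 h.2.2
      have hs0' := hGs false m p'.1 h'.1.1 h'.1.2
      have hs1' := hGs true m p'.2 h'.2.1 h'.2.2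
      -- the products are equal as elements of `St(1)`
      have eS : (⟨((G false m p.1 h.1.1 h.1.2 * G true m p.2 h.2.1 h.2.2 : ↥grigorchukGroup) : Equiv.Perm Ray),
            stabOne.mul_mem (rist_le_stabOne false (hGr false m p.1 h.1.1 h.1.2)) (rist_le_stabOne true (hGr true m p.2 h.2.1 h.2.2))⟩ : ↥stabOne) =
          ⟨((G false m p'.1 h'.1.1 h'.1.2 * G true m p'.2 h'.2.1 h'.2.2 : ↥grigorchukGroup) : Equiv.Perm Ray),
            stabOne.mul_mem (rist_le_stabOne false (hGr false m p'.1 h'.1.1 h'.1.2)) (rist_le_stabOne true (hGr true m p'.2 h'.2.1 h'.2.2))⟩ :=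
        Subtype.ext (congrArg (fun z : ↥grigorchukGroup => (z : Equiv.Perm Ray)) eF)
      have e0 := congrArg (fun z : ↥stabOne => sec false z) eS
      have e1 := congrArg (fun z : ↥stabOne => sec true z) eS
      have ex : (p.1 : Equiv.Perm Ray) = (p'.1 : Equiv.Perm Ray) := by rw [← hs0, ← hs0', ← k0, ← k0']; exact e0
      have ey : (p.2 : Equiv.Perm Ray) = (p'.2 : Equiv.Perm Ray) := by rw [← hs1, ← hs1', ← k1, ← k1']; exact e1
      exact Prod.ext (Subtype.ext ex) (Subtype.ext ey)
  have h1 := hcount n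
  calc (wordBall n).card ^ 2 ≤ (T * RB.card) ^ 2 := Nat.pow_le_pow_left h1 2
    _ = T ^ 2 * (RB ×ˢ RB).card := by rw [Finset.card_product]; ring
    _ ≤ T ^ 2 * (wordBall (2 * (max L₀ 1 * (n + c)))).card := Nat.mul_le_mul_left _ hinj

/-! ## §3 The iteration -/

/-- `k² < 2^k` for `k ≥ 5`. [folklore] -/
theorem sq_lt_two_pow {k : ℕ} (hk : 5 ≤ k) : k * k < 2 ^ k := by
  induction k, hk using Nat.le_induction with
  | base => decide
  | succ k hk ih =>
    have h2 : 2 * k + 1 ≤ k * k := by nlinarith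
    calc (k + 1) * (k + 1) = k * k + (2 * k + 1) := by ring
      _ < 2 ^ k + 2 ^ k := by omega
      _ = 2 ^ (k + 1) := by rw [pow_succ]; ring

/-- No doubly exponential sequence is bounded by a single exponential: `A·Q^k < 2^(2^k)` for some `k` (`A, Q ≥ 1`). [folklore] -/
theorem exists_lt_two_pow_two_pow (A Q : ℕ) : ∃ k : ℕ, A * Q ^ k < 2 ^ (2 ^ k) := by
  refine ⟨max (A + Q) 5, ?_⟩
  set k := max (A + Q) 5 with hk
  have hk5 : 5 ≤ k := le_max_right _ _
  have hkAQ : A + Q ≤ k := le_max_left _ _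
  have hA : A ≤ 2 ^ A := (Nat.lt_two_pow_self).le
  have hQ : Q ^ k ≤ 2 ^ (Q * k) := by rw [pow_mul]; exact Nat.pow_le_pow_left (Nat.lt_two_pow_self).le k
  have hexp : A + Q * k < 2 ^ k := by
    have h1 : A + Q * k ≤ (A + Q) * k := by nlinarith
    have h2 : (A + Q) * k ≤ k * k := Nat.mul_le_mul_right k hkAQ
    exact lt_of_le_of_lt (h1.trans h2) (sq_lt_two_pow hk5)
  calc A * Q ^ k ≤ 2 ^ A * 2 ^ (Q * k) := Nat.mul_le_mul hA hQ
    _ = 2 ^ (A + Q * k) := by rw [pow_add]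
    _ < 2 ^ (2 ^ k) := Nat.pow_lt_pow_right (by norm_num) hexp

/-- **A ball of any prescribed size**: `𝔊` is infinite (p594312), so some word ball has at least `N` elements. [cite: Grigorchuk1980, 𝔊 is infinite] -/
theorem exists_card_wordBall_ge (N : ℕ) : ∃ n : ℕ, 1 ≤ n ∧ N ≤ (wordBall n).card := by
  haveI : Infinite ↥grigorchukGroup := Set.infinite_coe_iff.2 grigorchukGroup_infinite
  obtain ⟨s, hs⟩ := Infinite.exists_subset_card_eq ↥grigorchukGroup N
  choose f hf using fun g : ↥grigorchukGroup => exists_mem_wordBall g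
  refine ⟨s.sup f + 1, by omega, ?_⟩
  rw [← hs]
  exact Finset.card_le_card fun g hg => wordBall_mono (by have := Finset.le_sup (f := f) hg; omega) (hf g)

/-- **THE ITERATION**: from a ball with `≥ 2T²` elements, `T²·2^(2^k) ≤ |wordBall (n k)|` along `n (k+1) = 2L(n k + c)`, with `n k ≤ (2L(c+1))^k · n 0`.
[cite: Grigorchuk1984, proof of the lower bound] -/
theorem iterate_sq {T c L n₀ : ℕ} (hT : 0 < T) (hL : 1 ≤ L) (hn₀ : 1 ≤ n₀) (hstart : 2 * T ^ 2 ≤ (wordBall n₀).card)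
    (hsq : ∀ n : ℕ, (wordBall n).card ^ 2 ≤ T ^ 2 * (wordBall (2 * (L * (n + c)))).card) :
    ∀ k : ℕ, T ^ 2 * 2 ^ (2 ^ k) ≤ (wordBall ((fun j => 2 * (L * (j + c)))^[k] n₀)).card ∧
      1 ≤ (fun j => 2 * (L * (j + c)))^[k] n₀ ∧ (fun j => 2 * (L * (j + c)))^[k] n₀ ≤ (2 * (L * (c + 1))) ^ k * n₀ := by
  intro k
  induction k with
  | zero => simp only [Function.iterate_zero, id_eq, pow_zero, pow_one, one_mul]; exact ⟨by linarith, hn₀, le_rfl⟩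
  | succ k ih =>
    obtain ⟨ih1, ih2, ih3⟩ := ih
    set nk := (fun j => 2 * (L * (j + c)))^[k] n₀ with hnk
    have hstep : (fun j => 2 * (L * (j + c)))^[k + 1] n₀ = 2 * (L * (nk + c)) := by
      rw [Function.iterate_succ_apply', ← hnk]
    rw [hstep]
    refine ⟨?_, ?_, ?_⟩
    · -- `T² |B(n_{k+1})| ≥ |B(n_k)|² ≥ T⁴ 2^(2^(k+1))`
      have h1 := hsq nk
      have h2 : (T ^ 2 * 2 ^ (2 ^ k)) ^ 2 ≤ (wordBall nk).card ^ 2 := Nat.pow_le_pow_left ih1 2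
      have h3 : (T ^ 2 * 2 ^ (2 ^ k)) ^ 2 = T ^ 2 * (T ^ 2 * 2 ^ (2 ^ (k + 1))) := by rw [pow_succ 2 k]; ring
      rw [h3] at h2
      exact Nat.le_of_mul_le_mul_left (h2.trans h1) (by positivity)
    · nlinarith
    · -- `2L(n_k + c) ≤ 2L(c+1)·n_k ≤ (2L(c+1))^(k+1) n₀`
      have h1 : nk + c ≤ (c + 1) * nk := by nlinarith
      calc 2 * (L * (nk + c)) ≤ 2 * (L * ((c + 1) * nk)) := by gcongr
        _ = (2 * (L * (c + 1))) * nk := by ring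
        _ ≤ (2 * (L * (c + 1))) * ((2 * (L * (c + 1))) ^ k * n₀) := Nat.mul_le_mul_left _ ih3
        _ = (2 * (L * (c + 1))) ^ (k + 1) * n₀ := by rw [pow_succ]; ring

/-! ## §4 No polynomial bound -/

/-- **THE FIRST GRIGORCHUK GROUP IS NOT OF POLYNOMIAL GROWTH — KERNEL: `Cay(𝔊; a, b, c, d)` admits NO bound `|B(x, n)| ≤ C·(n+1)^D`** (real `C`, `D`; exactly the
growth hypothesis of `BenjaminiSchramm1996_conj4_polynomialGrowth`, which therefore does not apply to this graph — nothing about the node's truth).  With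
«GrigorchukSubexponentialGrowth» `not_hasExponentialGrowth_cayley` (p611590): INTERMEDIATE growth, both halves kernel; no growth exponent typed.
[cite: Grigorchuk1984, Thm. (intermediate growth: the lower bound)] -/
theorem not_polynomialGrowth_cayley : ¬ ∃ C D : ℝ, ∀ (x : ↥grigorchukGroup) (n : ℕ),
    (ballVolume (mulCayley (↑({aG, bG, cG, dG} : Finset ↥grigorchukGroup) : Set ↥grigorchukGroup)) x n : ℝ) ≤ C * ((n : ℝ) + 1) ^ D := by
  rintro ⟨C, D, hCD⟩
  obtain ⟨T, c, L, hT, hL, hsq⟩ := card_wordBall_sq_le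
  obtain ⟨n₀, hn₀, hstart⟩ := exists_card_wordBall_ge (2 * T ^ 2)
  have hit := iterate_sq hT hL hn₀ hstart hsq
  -- integer envelope of the polynomial bound: `|wordBall n| ≤ C' (n+1)^D'`
  set D' : ℕ := ⌈max D 0⌉₊ with hD'
  set C' : ℕ := ⌈max C 1⌉₊ with hC'
  have hpoly : ∀ n : ℕ, (wordBall n).card ≤ C' * (n + 1) ^ D' := by
    intro n
    have h := hCD 1 n
    rw [ballVolume_eq_card_wordBall] at h
    have hn1 : (1 : ℝ) ≤ (n : ℝ) + 1 := by have := (Nat.cast_nonneg n : (0 : ℝ) ≤ n); linarith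
    have hDle : D ≤ (D' : ℝ) := (le_max_left D 0).trans (Nat.le_ceil _)
    have hrpow : ((n : ℝ) + 1) ^ D ≤ ((n : ℝ) + 1) ^ (D' : ℝ) := Real.rpow_le_rpow_of_exponent_le hn1 hDle
    have hCle : C ≤ (C' : ℝ) := (le_max_left C 1).trans (Nat.le_ceil _)
    have hpos : (0 : ℝ) ≤ ((n : ℝ) + 1) ^ D := Real.rpow_nonneg (by linarith) D
    have h2 : ((wordBall n).card : ℝ) ≤ (C' : ℝ) * ((n : ℝ) + 1) ^ (D' : ℝ) :=
      calc ((wordBall n).card : ℝ) ≤ C * ((n : ℝ) + 1) ^ D := h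
        _ ≤ (C' : ℝ) * ((n : ℝ) + 1) ^ D := mul_le_mul_of_nonneg_right hCle hpos
        _ ≤ (C' : ℝ) * ((n : ℝ) + 1) ^ (D' : ℝ) := mul_le_mul_of_nonneg_left hrpow (Nat.cast_nonneg _)
    rw [Real.rpow_natCast] at h2
    exact_mod_cast h2
  -- along the iteration: `T² 2^(2^k) ≤ C' (M^k n₀ + 1)^D' ≤ C' (n₀ + 1)^D' (M^D')^k`
  set M : ℕ := 2 * (L * (c + 1)) with hM
  have hM1 : 1 ≤ M := by rw [hM]; nlinarith
  obtain ⟨k, hk⟩ := exists_lt_two_pow_two_pow (C' * (n₀ + 1) ^ D') (M ^ D')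
  obtain ⟨h1, -, h3⟩ := hit k
  have h4 := hpoly ((fun j => 2 * (L * (j + c)))^[k] n₀)
  have h5 : ((fun j => 2 * (L * (j + c)))^[k] n₀ + 1) ^ D' ≤ ((n₀ + 1) * M ^ k) ^ D' := by
    apply Nat.pow_le_pow_left
    have : 1 ≤ M ^ k := Nat.one_le_pow _ _ hM1
    nlinarith
  have h6 : ((n₀ + 1) * M ^ k) ^ D' = (n₀ + 1) ^ D' * (M ^ D') ^ k := by rw [mul_pow, ← pow_mul, ← pow_mul, mul_comm k D']
  have hT1 : 1 ≤ T ^ 2 := Nat.one_le_pow _ _ hT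
  have : 2 ^ (2 ^ k) ≤ C' * (n₀ + 1) ^ D' * (M ^ D') ^ k :=
    calc 2 ^ (2 ^ k) ≤ T ^ 2 * 2 ^ (2 ^ k) := Nat.le_mul_of_pos_left _ (by positivity)
      _ ≤ (wordBall ((fun j => 2 * (L * (j + c)))^[k] n₀)).card := h1
      _ ≤ C' * ((fun j => 2 * (L * (j + c)))^[k] n₀ + 1) ^ D' := h4
      _ ≤ C' * ((n₀ + 1) ^ D' * (M ^ D') ^ k) := by rw [← h6]; exact Nat.mul_le_mul_left _ h5
      _ = C' * (n₀ + 1) ^ D' * (M ^ D') ^ k := by ring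
  exact absurd hk (not_lt.2 this)

end Grigorchuk

end Summit.CriticalPhenomena.PercolationContinuityZ3.Theorems.Transplant

end
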